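import Mathlib
import Literature.Analysis.FluidPDE.Tao2016AveragedNS.SelfSimilarCascadeBlowup
import Literature.Analysis.FluidPDE.Tao2016AveragedNS.ViscousEternalSolutions
import Literature.Analysis.FluidPDE.Tao2016AveragedNS.BoundedEternalSolutions
import Summits.NavierStokesRegularity.NavierStokesRegularity.Theses.TaoLadderRungTwoBreak
import HarnessLib

/-!
# `TaoLadderRungTwoBreak.BlowupRigidityOne` (item stmt-NavierStokesRegularity-20206, K2(1)) — the
  by-name LINK WEB of the crux in the tree: registered stubs ⇒ crux, Target ⇒ crux, crux ⇒ K2ᵛ(1) /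
  K2^∞_fwd(1), K1^∞_fwd(1) ⇒ the classification stub, extraction stub ∧ K1^∞_fwd(1) ⇒ Target

MODEL lattice ODEs only (Tao 2016 §4, the cell vocabulary of `RenormalisedCascadeWaves` /
`SelfSimilarCascadeBlowup` / `ViscousEternalSolutions` / `BoundedEternalSolutions`); nothing in this
file is a statement about the Navier–Stokes equations, and NO item is closed by it (`--supports
stmt-NavierStokesRegularity-20206`).

The registered skeleton of K2(1) (`BlowupRigidityOne_birth.lean`, sha16 9d85f4d387c689cd, planner
theory-1 g6) has two stubs, whose signatures are quoted VERBATIM below as hypotheses (never as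
definitions):

* `stub_eternalFromBlowup` («extraction», K2^∞_fwd(·,1)): below a threshold, robust blow-up
  (`NoGlobalCascade`) of an `E₂(R)` table from a one-shell datum yields an admissible eternal solution of
  the renormalised lattice that is (S₁)-surviving forward — LITERALLY `∀ R ≥ 1, EternalRigidityFwd R 1`
  (`stubEternalFromBlowup_iff`, `Iff.rfl`);
* `stub_eternalIsDSS` («classification»): below a threshold, an `E₂(R)` table that carries a
  forward-surviving admissible eternal solution carries a non-trivial (S₁)-surviving admissible DSS wave.

What this file records, kernel-checked against the tree (previously only in cell packages):

* `blowupRigidityOne_iff` — the crux is `∀ R ≥ 1, BlowupRigidity R 1` (`Iff.rfl`);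
* `blowupRigidityOne_of_stubs` — the skeleton's composition: both stubs give the crux (thresholds by `min`);
* `blowupRigidityOne_of_target`, `stubEternalFromBlowup_of_target` — the route's `Target` (no robust
  blow-up below `ε_R`) gives the crux and the extraction stub VACUOUSLY; the classification stub is NOT
  a consequence of the `Target` (its hypothesis does not mention blow-up) — it is a K1-type statement;
* `stubEternalFromBlowup_of_blowupRigidityOne` (`= eternalRigidityFwd_of_blowupRigidity`) and
  `eternalRigidityViscBddOne_of_blowupRigidityOne` — the crux implies its own extraction stub and the
  route's consequence-crux K2ᵛ(1) `EternalRigidityViscBddOne` (a DSS wave embeds as a uniformly bounded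
  `ν̂ = 0` eternal solution: `IsDSSWave.isEternal_dssEmbed`, `uniformBound_dssEmbed`,
  `eternalSurvivingFwd_dssEmbed`), and `eternalRigidityViscOne_of_stubEternalFromBlowup` (extraction
  stub ⇒ theory-2's unbounded K2ᵛ `EternalRigidityVisc R 1`);
* `stubEternalIsDSS_of_noSurvivingEternalFwdOne` — K1^∞_fwd(1) makes the classification stub vacuous;
* `target_of_stubEternalFromBlowup_of_noSurvivingEternalFwdOne` — the line card's collapse (referee
  c18): extraction stub ∧ K1^∞_fwd(1) already give the `Target`, WITHOUT the classification stub
  (`noRobustBlowupBelow_of_eternalFwd`), hence also the crux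
  (`blowupRigidityOne_of_stubEternalFromBlowup_of_noSurvivingEternalFwdOne`).

HONEST FRAMING: pure logic over the tree's predicates; the mathematical content of K2(1) (type-I
renormalised compactness of a robust blow-up, classification of surviving eternal solutions) is not
touched here.
-/

noncomputable section

-- the summit and its single sub-problem share the name (CONVENTIONS §1)
set_option linter.dupNamespace false

namespace Summit.NavierStokesRegularity.NavierStokesRegularity.Theorems

namespace BlowupRigidityOne

open Literature.Analysis.FluidPDE Literature.Analysis.FluidPDE.TaoCascade
open Summit.NavierStokesRegularity.NavierStokesRegularity.Theses.TaoLadderRungTwoBreak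

/-- The crux K2(1) is, by `rfl`, theory-2's rigidity predicate at exponent `a = 1` for every spread:
`BlowupRigidityOne ↔ ∀ R ≥ 1, BlowupRigidity R 1`.
[cite: Tao2016AveragedNS, §4 Thm. 4.2 (statement shape); cell vocabulary] -/
theorem blowupRigidityOne_iff :
    BlowupRigidityOne ↔ ∀ R : ℝ, 1 ≤ R → BlowupRigidity R 1 := Iff.rfl

/-- The registered extraction stub `stub_eternalFromBlowup` of the K2(1) skeleton (signature verbatim)
is, by `rfl`, theory-2's `∀ R ≥ 1, EternalRigidityFwd R 1` (K2^∞_fwd at `a = 1`).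
[cite: Tao2016AveragedNS, §4 Thm. 4.2 (statement shape), §6.4; cell vocabulary] -/
theorem stubEternalFromBlowup_iff :
    (∀ R : ℝ, 1 ≤ R → ∃ εs : ℝ, 0 < εs ∧ ∀ ε₀ : ℝ, 0 < ε₀ → ε₀ ≤ εs →
      ∀ (α : (Fin 4 → Fin 4 → Fin 4 → ℤ × ℤ × ℤ → ℝ)) (X₀ : Fin 4 → ℝ),
        InTableClass R α → NoGlobalCascade ε₀ α X₀ →
          ∃ W : ℤ → ℝ → Em 4, IsEternal ε₀ α W ∧ EternalSurvivingFwd 1 ε₀ W) ↔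
    ∀ R : ℝ, 1 ≤ R → EternalRigidityFwd R 1 := Iff.rfl

/-- **The skeleton's composition** (`BlowupRigidityOne_of` of the registered birth skeleton, here
against the tree): the extraction stub `stub_eternalFromBlowup` and the classification stub
`stub_eternalIsDSS` (both quoted verbatim) give the crux `BlowupRigidityOne` — thresholds combined by
`min`. [cite: Tao2016AveragedNS, §4 Thm. 4.2 (statement shape); cell vocabulary] -/
theorem blowupRigidityOne_of_stubs
    (hFrom : ∀ R : ℝ, 1 ≤ R → ∃ εs : ℝ, 0 < εs ∧ ∀ ε₀ : ℝ, 0 < ε₀ → ε₀ ≤ εs →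
      ∀ (α : (Fin 4 → Fin 4 → Fin 4 → ℤ × ℤ × ℤ → ℝ)) (X₀ : Fin 4 → ℝ),
        InTableClass R α → NoGlobalCascade ε₀ α X₀ →
          ∃ W : ℤ → ℝ → Em 4, IsEternal ε₀ α W ∧ EternalSurvivingFwd 1 ε₀ W)
    (hDSS : ∀ R : ℝ, 1 ≤ R → ∃ εs : ℝ, 0 < εs ∧ ∀ ε₀ : ℝ, 0 < ε₀ → ε₀ ≤ εs →
      ∀ α : (Fin 4 → Fin 4 → Fin 4 → ℤ × ℤ × ℤ → ℝ), InTableClass R α →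
        (∃ W : ℤ → ℝ → Em 4, IsEternal ε₀ α W ∧ EternalSurvivingFwd 1 ε₀ W) →
          ∃ (q : ℕ) (π : Equiv.Perm (Fin q)) (T : ℝ) (Φ : Fin q → ℝ → Em 4),
            IsDSSWave ε₀ α π T Φ ∧ Surviving 1 ε₀ T ∧ ∃ r x, Φ r x ≠ 0) :
    BlowupRigidityOne := by
  intro R hR
  obtain ⟨ε₁, hε₁, H1⟩ := hFrom R hR
  obtain ⟨ε₂, hε₂, H2⟩ := hDSS R hR
  refine ⟨min ε₁ ε₂, lt_min hε₁ hε₂, fun ε₀ hε₀ hle α X₀ hα hNG => ?_⟩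
  exact H2 ε₀ hε₀ (hle.trans (min_le_right _ _)) α hα
    (H1 ε₀ hε₀ (hle.trans (min_le_left _ _)) α X₀ hα hNG)

/-- **The `Target` gives the crux vacuously**: below `ε_R` no `E₂(R)` table blows up robustly, so the
antecedent `NoGlobalCascade ε₀ α X₀` of K2(1) is never met (the cell package's
`blowupRigidityOne_of_target`, now against the tree).
[cite: Tao2016AveragedNS, §4 Thm. 4.2 (statement shape); cell vocabulary] -/
theorem blowupRigidityOne_of_target (hT : Target) : BlowupRigidityOne := by
  intro R hR
  obtain ⟨εR, hεR, H⟩ := hT R hR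
  exact ⟨εR, hεR, fun ε₀ hε₀ hle α X₀ hα hNG => absurd hNG (H ε₀ hε₀ hle α X₀ hα)⟩

/-- **The `Target` gives the extraction stub vacuously** (`fromBlowup_of_target` of the line card: the
stub `stub_eternalFromBlowup` is a consequence of the leaf, so its BC5 rung stays plan-only).
[cite: Tao2016AveragedNS, §4 Thm. 4.2 (statement shape); cell vocabulary] -/
theorem stubEternalFromBlowup_of_target (hT : Target) :
    ∀ R : ℝ, 1 ≤ R → ∃ εs : ℝ, 0 < εs ∧ ∀ ε₀ : ℝ, 0 < ε₀ → ε₀ ≤ εs →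
      ∀ (α : (Fin 4 → Fin 4 → Fin 4 → ℤ × ℤ × ℤ → ℝ)) (X₀ : Fin 4 → ℝ),
        InTableClass R α → NoGlobalCascade ε₀ α X₀ →
          ∃ W : ℤ → ℝ → Em 4, IsEternal ε₀ α W ∧ EternalSurvivingFwd 1 ε₀ W := by
  intro R hR
  obtain ⟨εR, hεR, H⟩ := hT R hR
  exact ⟨εR, hεR, fun ε₀ hε₀ hle α X₀ hα hNG => absurd hNG (H ε₀ hε₀ hle α X₀ hα)⟩

/-- **The crux implies its own extraction stub** (K2 ⇒ K2^∞_fwd, `eternalRigidityFwd_of_blowupRigidity`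
at `a = 1`: the DSS wave embeds as an admissible eternal solution, forward-surviving because its delay
is (S₁)-surviving and the profile is non-trivial).
[cite: Tao2016AveragedNS, §4 Thm. 4.2 (statement shape), §6.4; cell vocabulary] -/
theorem stubEternalFromBlowup_of_blowupRigidityOne (h : BlowupRigidityOne) :
    ∀ R : ℝ, 1 ≤ R → ∃ εs : ℝ, 0 < εs ∧ ∀ ε₀ : ℝ, 0 < ε₀ → ε₀ ≤ εs →
      ∀ (α : (Fin 4 → Fin 4 → Fin 4 → ℤ × ℤ × ℤ → ℝ)) (X₀ : Fin 4 → ℝ),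
        InTableClass R α → NoGlobalCascade ε₀ α X₀ →
          ∃ W : ℤ → ℝ → Em 4, IsEternal ε₀ α W ∧ EternalSurvivingFwd 1 ε₀ W :=
  fun R hR => eternalRigidityFwd_of_blowupRigidity (h R hR)

/-- **K2(1) ⇒ K2ᵛ(1)** (the cell package's `eternalRigidityViscBddOne_of_blowupRigidityOne`, now
against the tree): the non-trivial (S₁)-surviving DSS wave produced by the crux embeds
(`dssEmbed`) as an admissible eternal solution with covariant viscosity `ν̂ = 0`
(`IsDSSWave.isEternal_dssEmbed`, `IsEternal.isEternalVisc`), UNIFORMLY BOUNDED in shell and log-time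
(`uniformBound_dssEmbed`) and forward (S₁)-surviving (`eternalSurvivingFwd_dssEmbed`). So the rev-1
crux is STRONGER than the route's consequence-crux `EternalRigidityViscBddOne`
(stmt-NavierStokesRegularity-20420). [cite: Tao2016AveragedNS, §4 Thm. 4.2 (statement shape), §6.4; cell vocabulary] -/
theorem eternalRigidityViscBddOne_of_blowupRigidityOne (h : BlowupRigidityOne) :
    EternalRigidityViscBddOne := by
  intro R hR
  obtain ⟨εs, hεs, H⟩ := h R hR
  refine ⟨εs, hεs, fun ε₀ hε₀ hle α X₀ hα hNG => ?_⟩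
  obtain ⟨q, π, T, Φ, hW, hS, r, x, hne⟩ := H ε₀ hε₀ hle α X₀ hα hNG
  exact ⟨0, dssEmbed π T Φ r, (hW.isEternal_dssEmbed r).isEternalVisc, uniformBound_dssEmbed hW r,
    eternalSurvivingFwd_dssEmbed hε₀ hW.delay_pos hS hne⟩

/-- **Extraction stub ⇒ theory-2's (unbounded) viscous extraction predicate** `EternalRigidityVisc R 1`
for every `R ≥ 1` (`eternalRigidityVisc_of_fwd`: the inviscid solution is the `ν̂ = 0` case).
[cite: Tao2016AveragedNS, §4 Thm. 4.2 (statement shape), §6.4; cell vocabulary] -/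
theorem eternalRigidityViscOne_of_stubEternalFromBlowup
    (hFrom : ∀ R : ℝ, 1 ≤ R → ∃ εs : ℝ, 0 < εs ∧ ∀ ε₀ : ℝ, 0 < ε₀ → ε₀ ≤ εs →
      ∀ (α : (Fin 4 → Fin 4 → Fin 4 → ℤ × ℤ × ℤ → ℝ)) (X₀ : Fin 4 → ℝ),
        InTableClass R α → NoGlobalCascade ε₀ α X₀ →
          ∃ W : ℤ → ℝ → Em 4, IsEternal ε₀ α W ∧ EternalSurvivingFwd 1 ε₀ W) :
    ∀ R : ℝ, 1 ≤ R → EternalRigidityVisc R 1 :=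
  fun R hR => eternalRigidityVisc_of_fwd (hFrom R hR)

/-- **K1^∞_fwd(1) makes the classification stub vacuous**: if below a threshold no `E₂(R)` table
carries a forward (S₁)-surviving admissible eternal solution at all (`NoSurvivingEternalFwd R 1` for
every `R ≥ 1`), then the hypothesis of `stub_eternalIsDSS` (quoted verbatim) is never met.
[cite: Tao2016AveragedNS, §4 Thm. 4.2 (statement shape), §6.4; cell vocabulary] -/
theorem stubEternalIsDSS_of_noSurvivingEternalFwdOne
    (h0 : ∀ R : ℝ, 1 ≤ R → NoSurvivingEternalFwd R 1) :
    ∀ R : ℝ, 1 ≤ R → ∃ εs : ℝ, 0 < εs ∧ ∀ ε₀ : ℝ, 0 < ε₀ → ε₀ ≤ εs →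
      ∀ α : (Fin 4 → Fin 4 → Fin 4 → ℤ × ℤ × ℤ → ℝ), InTableClass R α →
        (∃ W : ℤ → ℝ → Em 4, IsEternal ε₀ α W ∧ EternalSurvivingFwd 1 ε₀ W) →
          ∃ (q : ℕ) (π : Equiv.Perm (Fin q)) (T : ℝ) (Φ : Fin q → ℝ → Em 4),
            IsDSSWave ε₀ α π T Φ ∧ Surviving 1 ε₀ T ∧ ∃ r x, Φ r x ≠ 0 := by
  intro R hR
  obtain ⟨εs, hεs, H⟩ := h0 R hR
  refine ⟨εs, hεs, fun ε₀ hε₀ hle α hα hW => ?_⟩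
  obtain ⟨W, hE, hS⟩ := hW
  exact absurd hS (H ε₀ hε₀ hle α hα W hE)

/-- **The line card's collapse (referee c18, `target_of_liouville_fromBlowup`)**: the extraction stub
`stub_eternalFromBlowup` together with K1^∞_fwd(1) (`NoSurvivingEternalFwd R 1` for every `R ≥ 1`,
the inviscid eternal Liouville statement) already gives the route's `Target` — WITHOUT the
classification stub — by `noRobustBlowupBelow_of_eternalFwd` spread by spread.
[cite: Tao2016AveragedNS, §4 Thm. 4.2 (statement shape), §6.4; cell vocabulary] -/
theorem target_of_stubEternalFromBlowup_of_noSurvivingEternalFwdOne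
    (hFrom : ∀ R : ℝ, 1 ≤ R → ∃ εs : ℝ, 0 < εs ∧ ∀ ε₀ : ℝ, 0 < ε₀ → ε₀ ≤ εs →
      ∀ (α : (Fin 4 → Fin 4 → Fin 4 → ℤ × ℤ × ℤ → ℝ)) (X₀ : Fin 4 → ℝ),
        InTableClass R α → NoGlobalCascade ε₀ α X₀ →
          ∃ W : ℤ → ℝ → Em 4, IsEternal ε₀ α W ∧ EternalSurvivingFwd 1 ε₀ W)
    (h0 : ∀ R : ℝ, 1 ≤ R → NoSurvivingEternalFwd R 1) : Target :=
  fun R hR => noRobustBlowupBelow_of_eternalFwd (h0 R hR) (hFrom R hR)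

/-- Hence the extraction stub and K1^∞_fwd(1) also give the crux itself (through the `Target`,
vacuously): under the inviscid eternal Liouville statement the classification stub is MOOT for K2(1).
[cite: Tao2016AveragedNS, §4 Thm. 4.2 (statement shape), §6.4; cell vocabulary] -/
theorem blowupRigidityOne_of_stubEternalFromBlowup_of_noSurvivingEternalFwdOne
    (hFrom : ∀ R : ℝ, 1 ≤ R → ∃ εs : ℝ, 0 < εs ∧ ∀ ε₀ : ℝ, 0 < ε₀ → ε₀ ≤ εs →
      ∀ (α : (Fin 4 → Fin 4 → Fin 4 → ℤ × ℤ × ℤ → ℝ)) (X₀ : Fin 4 → ℝ),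
        InTableClass R α → NoGlobalCascade ε₀ α X₀ →
          ∃ W : ℤ → ℝ → Em 4, IsEternal ε₀ α W ∧ EternalSurvivingFwd 1 ε₀ W)
    (h0 : ∀ R : ℝ, 1 ≤ R → NoSurvivingEternalFwd R 1) : BlowupRigidityOne :=
  blowupRigidityOne_of_target (target_of_stubEternalFromBlowup_of_noSurvivingEternalFwdOne hFrom h0)

/-- **K2(1) and K1^∞_fwd(1) decide the `Target`** (the mixed glue
`noRobustBlowupBelow_of_noSurvivingEternalFwd_of_rigidity` at `a = 1`, spread by spread).
[cite: Tao2016AveragedNS, §4 Thm. 4.2 (statement shape), §6.4; cell vocabulary] -/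
theorem target_of_blowupRigidityOne_of_noSurvivingEternalFwdOne (h : BlowupRigidityOne)
    (h0 : ∀ R : ℝ, 1 ≤ R → NoSurvivingEternalFwd R 1) : Target :=
  fun R hR => noRobustBlowupBelow_of_noSurvivingEternalFwd_of_rigidity (h0 R hR) (h R hR)

/-! ## Appended 2026-08-31 (same hand): the route's deciding hypotheses and a RESHAPED composition

Two more links.  (1) Under the route's two deciding hypotheses K1ᵛ(1) `NoSurvivingEternalViscBddOne` and
K2ᵛ(1) `EternalRigidityViscBddOne` the crux K2(1) holds (through `closes` and the `Target`, vacuously) —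
so K2(1) is never load-bearing for the route.  (2) The composition a NON-vacuous proof of K2(1) would
use: the route's bounded viscous extraction K2ᵛ(1) (itself = crux ⟨22743⟩ `WakeRatchet.MinimalViscousBlowup`
+ the PROVED extraction ⟨22744⟩) followed by a CLASSIFICATION of uniformly bounded, forward
(S₁)-surviving admissible viscous-eternal solutions into non-trivial (S₁)-surviving DSS waves — the
honest remaining content of the registered stub `stub_eternalIsDSS`, here with the extra hypotheses
`UniformBound W` and a covariant viscosity `ν̂ ≥ 0` that the extraction actually delivers. -/

/-- **K1ᵛ(1) ∧ K2ᵛ(1) ⇒ K2(1)**: the route's deciding hypotheses give the `Target` (`closes`), hence the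
crux `BlowupRigidityOne` vacuously (`blowupRigidityOne_of_target`).
[cite: Tao2016AveragedNS, §4 Thm. 4.2 (statement shape); cell vocabulary] -/
theorem blowupRigidityOne_of_deciding (h₁ : NoSurvivingEternalViscBddOne)
    (h₂ : EternalRigidityViscBddOne) : BlowupRigidityOne :=
  blowupRigidityOne_of_target (closes h₁ h₂)

/-- **RESHAPED COMPOSITION for a non-vacuous proof of K2(1)**: the bounded viscous extraction K2ᵛ(1)
`EternalRigidityViscBddOne` (stmt-NavierStokesRegularity-20420) and a classification of UNIFORMLY BOUNDED
forward-(S₁)-surviving admissible eternal solutions with covariant viscosity `ν̂ ≥ 0`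
(`IsEternalVisc ε₀ ν̂ α W ∧ UniformBound W ∧ EternalSurvivingFwd 1 ε₀ W`) into non-trivial (S₁)-surviving
admissible DSS waves, below a threshold on every `E₂(R)`, give `BlowupRigidityOne` (thresholds by
`min`).  The classification hypothesis is spelled out, not defined; it is WEAKER than the registered
`stub_eternalIsDSS` (which classifies all forward-surviving `IsEternal` solutions, bounded or not) on the
`ν̂ = 0` slice and is what an ω-limit argument can feed.
[cite: Tao2016AveragedNS, §4 Thm. 4.2 (statement shape), §6.4; cell vocabulary] -/
theorem blowupRigidityOne_of_eternalRigidityViscBddOne_of_classification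
    (h₂ : EternalRigidityViscBddOne)
    (hcl : ∀ R : ℝ, 1 ≤ R → ∃ εs : ℝ, 0 < εs ∧ ∀ ε₀ : ℝ, 0 < ε₀ → ε₀ ≤ εs →
      ∀ α : (Fin 4 → Fin 4 → Fin 4 → ℤ × ℤ × ℤ → ℝ), InTableClass R α →
        (∃ (νh : ℝ) (W : ℤ → ℝ → Em 4),
            IsEternalVisc ε₀ νh α W ∧ UniformBound W ∧ EternalSurvivingFwd 1 ε₀ W) →
          ∃ (q : ℕ) (π : Equiv.Perm (Fin q)) (T : ℝ) (Φ : Fin q → ℝ → Em 4),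
            IsDSSWave ε₀ α π T Φ ∧ Surviving 1 ε₀ T ∧ ∃ r x, Φ r x ≠ 0) :
    BlowupRigidityOne := by
  intro R hR
  obtain ⟨ε₁, hε₁, H1⟩ := h₂ R hR
  obtain ⟨ε₂, hε₂, H2⟩ := hcl R hR
  refine ⟨min ε₁ ε₂, lt_min hε₁ hε₂, fun ε₀ hε₀ hle α X₀ hα hNG => ?_⟩
  exact H2 ε₀ hε₀ (hle.trans (min_le_right _ _)) α hα
    (H1 ε₀ hε₀ (hle.trans (min_le_left _ _)) α X₀ hα hNG)

/-- The registered classification stub `stub_eternalIsDSS` (quoted verbatim) IMPLIES the bounded-viscous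
classification above on the inviscid slice: a uniformly bounded `ν̂ = 0` solution is in particular an
admissible `IsEternal` solution (`isEternalVisc_zero_iff`).  Recorded to show the reshaped hypothesis is
the weaker one where both speak. [cite: Tao2016AveragedNS, §4 Thm. 4.2 (statement shape), §6.4; cell vocabulary] -/
theorem classificationInviscid_of_stubEternalIsDSS
    (hDSS : ∀ R : ℝ, 1 ≤ R → ∃ εs : ℝ, 0 < εs ∧ ∀ ε₀ : ℝ, 0 < ε₀ → ε₀ ≤ εs →
      ∀ α : (Fin 4 → Fin 4 → Fin 4 → ℤ × ℤ × ℤ → ℝ), InTableClass R α →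
        (∃ W : ℤ → ℝ → Em 4, IsEternal ε₀ α W ∧ EternalSurvivingFwd 1 ε₀ W) →
          ∃ (q : ℕ) (π : Equiv.Perm (Fin q)) (T : ℝ) (Φ : Fin q → ℝ → Em 4),
            IsDSSWave ε₀ α π T Φ ∧ Surviving 1 ε₀ T ∧ ∃ r x, Φ r x ≠ 0) :
    ∀ R : ℝ, 1 ≤ R → ∃ εs : ℝ, 0 < εs ∧ ∀ ε₀ : ℝ, 0 < ε₀ → ε₀ ≤ εs →
      ∀ α : (Fin 4 → Fin 4 → Fin 4 → ℤ × ℤ × ℤ → ℝ), InTableClass R α →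
        (∃ W : ℤ → ℝ → Em 4, IsEternalVisc ε₀ 0 α W ∧ UniformBound W ∧ EternalSurvivingFwd 1 ε₀ W) →
          ∃ (q : ℕ) (π : Equiv.Perm (Fin q)) (T : ℝ) (Φ : Fin q → ℝ → Em 4),
            IsDSSWave ε₀ α π T Φ ∧ Surviving 1 ε₀ T ∧ ∃ r x, Φ r x ≠ 0 := by
  intro R hR
  obtain ⟨εs, hεs, H⟩ := hDSS R hR
  refine ⟨εs, hεs, fun ε₀ hε₀ hle α hα hW => ?_⟩
  obtain ⟨W, hE, -, hS⟩ := hW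
  exact H ε₀ hε₀ hle α hα ⟨W, isEternalVisc_zero_iff.1 hE, hS⟩

end BlowupRigidityOne

end Summit.NavierStokesRegularity.NavierStokesRegularity.Theorems

end
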